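import Mathlib.MeasureTheory.Measure.Lebesgue.Basic
import Mathlib.MeasureTheory.Measure.Dirac
import Mathlib.MeasureTheory.Measure.Real
import Mathlib.Tactic.IntervalCases
import HarnessLib

/-!
# rh-explicit (venture WeilGRH, weil-3 structure seat): an ℕ-valued measure of mass one on a window is a Dirac mass; gluing windows and null chains

Cell `rh-explicit`, WEIL TRACK (structure seat weil-3, gen17) — the measure-theoretic glue that turns the kernel certificates of a rung
(`RigidityWindows<Rung>`: every window `W_j` has `μ(W_j) < 2`; `RigidityComplete<Rung>`: `μ(W_j) > 0`, hence `μ.real W_j = 1`; the chains between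
the windows are `μ`-null) into the quotable STRUCTURE THEOREM «`μ|[0, R] = δ_{t₀} + ⋯ + δ_{t_{n-1}}` with `t_j ∈ W_j`» for every positive measure
representing Weil's form on the tests of the rung that is ℕ-valued on bounded Borel sets.

* `exists_restrict_Icc_eq_dirac` ★: `μ` ℕ-valued on bounded Borel sets, `μ.real [l, r] = 1` ⟹ `∃ t ∈ [l, r], μ {t} = 1 ∧ μ|[l, r] = δ_t`
  (the distribution function `s ↦ μ [l, s]` is `{0, 1}`-valued; `t` is the infimum of where it is `1`; continuity from above puts the jump AT `t`).
* `restrict_Icc_glue` ★: `μ|[x, y] = ν`, `μ {y} = 0`, `μ|[y, c] = δ_t`, `μ [c, d] = 0` ⟹ `μ|[x, d] = ν + δ_t` — one step of the chain/window walk;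
  `restrict_Icc_of_null_right`, `measure_singleton_null_of_Icc_null` are the small companions.

Pure measure theory (Mathlib only); no named facts, no kernel computation; standard axioms.  Nothing here bears on the truth of RH.
-/

set_option autoImplicit false

namespace Summit.Ventures.WeilGRH.Christoffel

open MeasureTheory Set Filter Topology

variable {μ : Measure ℝ} {l r : ℝ}

/-- An ℕ-valued measure takes only the values `0` and `1` on the Borel subsets of a set of mass `1`. -/
theorem measure_eq_zero_or_one_of_natValued
    (hN : ∀ s : Set ℝ, MeasurableSet s → Bornology.IsBounded s → ∃ k : ℕ, μ.real s = k)
    (h1 : μ (Icc l r) = 1) {B : Set ℝ} (hB : MeasurableSet B) (hBW : B ⊆ Icc l r) :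
    μ B = 0 ∨ μ B = 1 := by
  obtain ⟨k, hk⟩ := hN B hB ((Metric.isBounded_Icc l r).subset hBW)
  have hle : μ B ≤ 1 := h1 ▸ measure_mono hBW
  have hfin : μ B ≠ ⊤ := ne_top_of_le_ne_top ENNReal.one_ne_top hle
  have hBk : μ B = (k : ENNReal) := by
    rw [measureReal_def] at hk
    rw [← ENNReal.ofReal_toReal hfin, hk, ENNReal.ofReal_natCast]
  rw [hBk] at hle ⊢
  have hk1 : k ≤ 1 := by exact_mod_cast hle
  interval_cases k <;> simp

/-- ★ **An ℕ-valued measure giving mass exactly one to a window is a Dirac mass there.**  If `μ` takes ℕ values on bounded Borel sets and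
`μ.real [l, r] = 1`, then there is `t ∈ [l, r]` with `μ {t} = 1` and `μ|[l, r] = δ_t`. -/
theorem exists_restrict_Icc_eq_dirac
    (hN : ∀ s : Set ℝ, MeasurableSet s → Bornology.IsBounded s → ∃ k : ℕ, μ.real s = k)
    (h1 : μ.real (Icc l r) = 1) :
    ∃ t ∈ Icc l r, μ {t} = 1 ∧ μ.restrict (Icc l r) = Measure.dirac t := by
  have hW : μ (Icc l r) = 1 := by
    rw [measureReal_def] at h1
    exact (ENNReal.toReal_eq_one_iff _).1 h1
  have hlr : l ≤ r := by
    by_contra h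
    rw [Icc_eq_empty h, measure_empty] at hW
    exact zero_ne_one hW
  have dich : ∀ B : Set ℝ, MeasurableSet B → B ⊆ Icc l r → μ B = 0 ∨ μ B = 1 :=
    fun B hB hBW ↦ measure_eq_zero_or_one_of_natValued hN hW hB hBW
  -- `T` = where the distribution function `s ↦ μ [l, s]` is positive (hence `≥ 1`)
  set T : Set ℝ := {s | μ (Icc l s) ≠ 0} with hT
  have hrT : r ∈ T := by
    show μ (Icc l r) ≠ 0
    rw [hW]; exact one_ne_zero
  have hTl : ∀ s ∈ T, l ≤ s := by
    intro s hs
    by_contra h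
    exact hs (by rw [Icc_eq_empty h, measure_empty])
  have hbdd : BddBelow T := ⟨l, hTl⟩
  have one_le : ∀ s ∈ T, 1 ≤ μ (Icc l s) := by
    intro s hs
    rcases le_or_gt s r with hsr | hsr
    · rcases dich _ measurableSet_Icc (Icc_subset_Icc_right hsr) with h0 | h0
      · exact absurd h0 hs
      · rw [h0]
    · calc (1 : ENNReal) = μ (Icc l r) := hW.symm
        _ ≤ μ (Icc l s) := measure_mono (Icc_subset_Icc_right hsr.le)
  set t := sInf T with ht
  have htr : t ≤ r := csInf_le hbdd hrT
  have hlt : l ≤ t := le_csInf ⟨r, hrT⟩ hTl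
  -- strictly below `t` the distribution function vanishes
  have below : ∀ s < t, μ (Icc l s) = 0 := by
    intro s hs
    by_contra h
    exact absurd (csInf_le hbdd (show s ∈ T from h)) (not_le.2 hs)
  -- at `t` it equals one (continuity from above along `t + 1/(n+1)`)
  have at_t : μ (Icc l t) = 1 := by
    rcases dich _ measurableSet_Icc (Icc_subset_Icc_right htr) with h0 | h0
    swap
    · exact h0
    exfalso
    rcases eq_or_lt_of_le htr with heq | hlt'
    · rw [heq, hW] at h0; exact one_ne_zero h0
    have hanti : Antitone (fun n : ℕ ↦ Icc l (t + 1 / ((n : ℝ) + 1))) := by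
      intro m n hmn
      have hmn' : (m : ℝ) + 1 ≤ (n : ℝ) + 1 := by
        have : (m : ℝ) ≤ n := by exact_mod_cast hmn
        linarith
      exact Icc_subset_Icc_right (by
        have := one_div_le_one_div_of_le (by positivity) hmn'
        linarith)
    have hinter : (⋂ n : ℕ, Icc l (t + 1 / ((n : ℝ) + 1))) = Icc l t := by
      ext x
      simp only [mem_iInter, mem_Icc]
      constructor
      · intro h
        refine ⟨(h 0).1, le_of_forall_pos_lt_add fun ε hε ↦ ?_⟩
        obtain ⟨n, hn⟩ := exists_nat_one_div_lt hε
        exact lt_of_le_of_lt (h n).2 (by linarith)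
      · intro h n
        exact ⟨h.1, h.2.trans (le_add_of_nonneg_right (by positivity))⟩
    obtain ⟨n₀, hn₀⟩ := exists_nat_one_div_lt (sub_pos.2 hlt')
    have hfin : ∃ n : ℕ, μ (Icc l (t + 1 / ((n : ℝ) + 1))) ≠ ⊤ := by
      refine ⟨n₀, ne_top_of_le_ne_top ENNReal.one_ne_top ?_⟩
      rw [← hW]
      exact measure_mono (Icc_subset_Icc_right (by linarith))
    have hlim := hanti.measure_iInter (fun n ↦ measurableSet_Icc.nullMeasurableSet) hfin
    rw [hinter, h0] at hlim
    have hlt1 : ⨅ n : ℕ, μ (Icc l (t + 1 / ((n : ℝ) + 1))) < 1 := by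
      rw [← hlim]; exact zero_lt_one
    obtain ⟨n, hn⟩ := iInf_lt_iff.1 hlt1
    -- `t + 1/(n+1)` is a lower bound of `T`, contradicting `t = inf T`
    have hlb : ∀ u ∈ T, t + 1 / ((n : ℝ) + 1) ≤ u := by
      intro u hu
      by_contra hcon
      push Not at hcon
      have h1u := (one_le u hu).trans (measure_mono (Icc_subset_Icc_right hcon.le))
      exact absurd (h1u.trans_lt hn) (lt_irrefl _)
    have hle := le_csInf ⟨r, hrT⟩ hlb
    have hpos : (0 : ℝ) < 1 / ((n : ℝ) + 1) := by positivity
    rw [← ht] at hle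
    linarith
  -- `[l, t)` is null (countable union of null initial segments)
  have hIco : μ (Ico l t) = 0 := by
    have hsub : Ico l t ⊆ ⋃ n : ℕ, Icc l (t - 1 / ((n : ℝ) + 1)) := by
      intro x hx
      obtain ⟨n, hn⟩ := exists_nat_one_div_lt (sub_pos.2 hx.2)
      exact mem_iUnion.2 ⟨n, hx.1, by linarith⟩
    refine measure_mono_null hsub (measure_iUnion_null fun n ↦ below _ ?_)
    have hpos : (0 : ℝ) < 1 / ((n : ℝ) + 1) := by positivity
    linarith
  -- the atom at `t`
  have hatom : μ {t} = 1 := by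
    apply le_antisymm
    · rw [← hW]; exact measure_mono (singleton_subset_iff.2 ⟨hlt, htr⟩)
    · have hcov : Icc l t ⊆ Ico l t ∪ {t} := by
        intro x hx
        rcases eq_or_lt_of_le hx.2 with h | h
        · exact Or.inr h
        · exact Or.inl ⟨hx.1, h⟩
      calc (1 : ENNReal) = μ (Icc l t) := at_t.symm
        _ ≤ μ (Ico l t ∪ {t}) := measure_mono hcov
        _ ≤ μ (Ico l t) + μ {t} := measure_union_le _ _
        _ = μ {t} := by rw [hIco, zero_add]
  have hrest : μ (Icc l r \ {t}) = 0 := by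
    have hsub : ({t} : Set ℝ) ⊆ Icc l r := singleton_subset_iff.2 (show t ∈ Icc l r from ⟨hlt, htr⟩)
    rw [measure_sdiff hsub (measurableSet_singleton t).nullMeasurableSet
      (by rw [hatom]; exact ENNReal.one_ne_top), hW, hatom, tsub_self]
  refine ⟨t, ⟨hlt, htr⟩, hatom, Measure.ext fun B hB ↦ ?_⟩
  rw [Measure.restrict_apply hB, Measure.dirac_apply' _ hB]
  by_cases htB : t ∈ B
  · rw [indicator_of_mem htB, Pi.one_apply]
    apply le_antisymm
    · rw [← hW]; exact measure_mono inter_subset_right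
    · rw [← hatom]; exact measure_mono (singleton_subset_iff.2 (show t ∈ B ∩ Icc l r from ⟨htB, hlt, htr⟩))
  · rw [indicator_of_notMem htB]
    have hsub : B ∩ Icc l r ⊆ Icc l r \ {t} := by
      intro x hx
      refine ⟨hx.2, ?_⟩
      rintro (rfl : x = t)
      exact htB hx.1
    exact measure_mono_null hsub hrest

/-- A `μ`-null closed interval glued on the right does not change the restriction: `μ [y, d] = 0 ⟹ μ|[x, d] = μ|[x, y]`. -/
theorem restrict_Icc_of_null_right {x y d : ℝ} (hyd : y ≤ d) (h0 : μ (Icc y d) = 0) :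
    μ.restrict (Icc x d) = μ.restrict (Icc x y) := by
  apply Measure.restrict_congr_set
  refine ae_eq_set.2 ⟨?_, ?_⟩
  · refine measure_mono_null (fun z hz ↦ ?_) h0
    simp only [Set.mem_sdiff, mem_Icc, not_and, not_le] at hz
    exact ⟨(hz.2 hz.1.1).le, hz.1.2⟩
  · rw [sdiff_eq_empty.2 (Icc_subset_Icc_right hyd), measure_empty]

/-- The right end point of a `μ`-null closed interval is a `μ`-null singleton. -/
theorem measure_singleton_null_of_Icc_null {c y : ℝ} (hcy : c ≤ y) (h : μ (Icc c y) = 0) : μ {y} = 0 :=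
  measure_mono_null (singleton_subset_iff.2 (show y ∈ Icc c y from ⟨hcy, le_rfl⟩)) h

/-- A `μ`-null closed interval has zero restriction (the start of the chain/window walk). -/
theorem restrict_Icc_null {x y : ℝ} (h : μ (Icc x y) = 0) : μ.restrict (Icc x y) = 0 :=
  Measure.restrict_eq_zero.2 h

/-- ★ **gluing step of the chain/window walk**: if `μ|[x, y] = ν`, `μ {y} = 0`, the window `[y, c]` carries exactly `δ_t`, and the chain `[c, d]`
is `μ`-null, then `μ|[x, d] = ν + δ_t`. -/
theorem restrict_Icc_glue {x y c d t : ℝ} {ν : Measure ℝ} (hxy : x ≤ y) (hyc : y ≤ c) (hcd : c ≤ d)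
    (h1 : μ.restrict (Icc x y) = ν) (hy : μ {y} = 0) (hW : μ.restrict (Icc y c) = Measure.dirac t)
    (hC : μ (Icc c d) = 0) : μ.restrict (Icc x d) = ν + Measure.dirac t := by
  rw [restrict_Icc_of_null_right hcd hC, ← Icc_union_Icc_eq_Icc hxy hyc,
    Measure.restrict_union₀ _ measurableSet_Icc.nullMeasurableSet, h1, hW]
  exact measure_mono_null (fun z hz ↦ show z = y from le_antisymm hz.1.2 hz.2.1) hy

end Summit.Ventures.WeilGRH.Christoffel
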